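import Mathlib.Algebra.Category.Grp.Injective
import Mathlib.Algebra.Module.Projective
import Mathlib.LinearAlgebra.FreeModule.Basic
import Literature.NumberTheory.EllipticCurves.CanonicalPAdicHeight
import HarnessLib

/-!
# Existence of the canonical `p`-adic height (`exists_isCanonical`): the algebraic skeleton,
# proved, and the analytic inputs, as named facts

Trunk T-NT-EC (Literature/NumberTheory/EllipticCurves); sibling of `CanonicalPAdicHeight.lean`,
work towards discharging its named fact `WeierstrassCurve.exists_isCanonical` (for `E/ℚ` with
globally minimal `W` and `p ≥ 5` good ordinary there is a symmetric bilinear torsion-vanishing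
`PAdicHeightData W p` whose quadratic form on admissible points is the sigma formula
`ĥ_p(P) = log_p(den x(P)) - 2 log_p σ_p(z(P))`, Stein–Wuthrich 2013 §4.1 (4.1) /
Mazur–Stein–Tate 2006 §1 (1.1)).

The printed proof (MST 2006, §1: "`h_p` extends uniquely to a function on the full Mordell–Weil
group … `h_p(nQ) = n² h_p(Q)`"; §2.7: "`h_ρ` is quadratic because of property IV of `σ` in
[MT91], and the `h_ρ`-pairing is then visibly bilinear") has an ALGEBRAIC half and an ANALYTIC
half. This file PROVES the algebraic half in full generality and VENDORS the analytic half as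
precisely cited named facts (D-0014: nothing asserted), then assembles:

* `Literature.NumberTheory.EllipticCurves.exists_biadditive_extend` — a biadditive map `H × H → L` on a subgroup `H ≤ A` with
  values in a field of characteristic zero extends to `A × A` (`L` is an injective `ℤ`-module:
  Mathlib `Module.Baer.of_divisible`, `Module.Baer.extension_property_addMonoidHom`, plus an
  `L`-linear section of the restriction map);
* `Literature.NumberTheory.EllipticCurves.exists_pairing_of_parallelogram` — Jordan–von Neumann on a subgroup: a function
  satisfying the parallelogram law on `H` is, on `H`, the quadratic form of a symmetric
  biadditive torsion-vanishing pairing defined on all of `A`;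
* `Literature.NumberTheory.EllipticCurves.parallelogram_of_generic` — on a torsion-free subgroup the parallelogram law for
  "generic" pairs (`P, Q, P ± Q ≠ 0`, the only ones for which the sigma / local-height identities
  are printed) implies the full parallelogram law;
* named facts (inputs): `localConditionsLocus_isAddSubgroup` (`{O} ∪` admissible locus
  `= E(ℚ) ∩ E₁(ℚ_p) ∩ ⋂ E⁰(ℚ_ℓ)` is a subgroup, AEC VII.2.1–2.2),
  `not_isOfFinAddOrder_of_one_lt_padicNorm` (`E₁(ℚ_p)` is torsion-free for odd `p`,
  AEC IV.6.1), `canonicalPAdicHeight_parallelogram` (the sigma formula satisfies the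
  parallelogram law on generic admissible pairs, MST 2006 §2.7 / MT 1991);
* `exists_isCanonical_of_parallelogram : … → exists_isCanonical` (PROVED), and the `∃!` version
  given `exists_admissible_nsmul`;
* the next layer behind `canonicalPAdicHeight_parallelogram`, as named facts for later
  discharge: `padicSigma_theta` (Mazur–Tate's theta relation
  `σ(u+v)σ(u-v)/(σ(u)²σ(v)²) = x(v) - x(u)` on the kernel of reduction, Blakestad–Grant 2023
  Prop. 14 / MT 1991) and `padicValNat_den_parallelogram` (Néron's quasi-parallelogram law at a
  prime of non-singular reduction in denominator form, ATAEC VI.4.1 + Ex. 6.3); with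
  `mazur_tate_sigma_existsUnique` (`PadicSigma.lean`) and `Literature.NumberTheory.EllipticCurves.padicLog_mul`
  (`PAdicHeights.lean`) these are all the inputs of the printed argument.

## Sources (read)

* B. Mazur, W. Stein, J. Tate, *Computation of `p`-adic heights and log convergence*, Doc. Math.
  Extra Vol. Coates (2006): §1 p. 2–3 (eq. (1.1), "extends uniquely", Thm. 1.3), §2.3–2.4
  (`σ_v` on `E₁(K_v)`, `λ_v`, `σ̃_v`), §2.6 ("replacing `α, β` by `mα, nβ` … `(α,β) = (mα,nβ)/mn`"),
  §2.7 ("`h_ρ` is quadratic because of property IV of `σ` in [MT91]"), §2.8.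
* C. Blakestad, D. Grant, *On the universal `p`-adic sigma and Weierstrass zeta functions*,
  J. Number Theory 249 (2023) (arXiv:1903.02480): §3 (Mazur–Tate's characterisation of `σ_{E/A}`
  by the theta relation on the kernel of reduction), Prop. 14 (universal theta relation from the
  differential equation and oddness).
* J. H. Silverman, *Advanced Topics* (ATAEC), Thm. VI.1.1, Cor. VI.3.3, Thm. VI.4.1
  (`λ(P) = ½ max{v(x(P)⁻¹), 0} + v(Δ)/12` on `E₀(K)`, any `v`-integral equation), Ex. 6.3
  (quasi-parallelogram law); J. H. Silverman, *AEC*, IV.3.2, IV.6.1, VII.2.1, VII.2.2, VII.3.1.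
* D. Harvey, *Efficient computation of `p`-adic heights*, LMS JCM 11 (2008), §2.2 (conditions
  (A1), (A2); `h_p(P) = 2 log_p(σ(P)/d(P))`), §5.1 (`d(mQ) = ± ψ̂_m(Q) d(Q)`, Wuthrich).
* W. Stein, C. Wuthrich, Math. Comp. 82 (2013), §4.1 eq. (4.1) (the normalisation vendored in
  `CanonicalPAdicHeight.lean`).

## Design notes

* All three inputs are stated on COORDINATES, matching `CanonicalPAdicHeight.lean`; the generic
  pairs are `P ≠ ±Q` (`x(P) ≠ x(Q)`), for which `P ± Q ≠ O` and all four of `P, Q, P ± Q` lie in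
  the admissible locus, so that no junk value of `canonicalPAdicHeight`, `log_p` or `σ_p` enters.
  The degenerate pairs are recovered algebraically (`parallelogram_of_generic`) using only that
  `E₁(ℚ_p)` is torsion-free (`p ≥ 3`), never a duplication formula for `σ_p`.
* `localConditionsLocus_isAddSubgroup` is stated for every prime `p` (for `p = 2` the sigma-disc
  condition cuts `E₁(ℚ₂)` down to the subgroup `Ê(4ℤ₂)`, AEC IV.3.2(a)); the torsion fact for
  `p ≥ 3` (AEC IV.6.1 with `v(p) = 1 < p - 1`); the parallelogram and theta facts under the
  hypotheses of `mazur_tate_sigma_existsUnique` (`p ≥ 5` good ordinary, `W` globally minimal),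
  under which `padicSigma` IS the Mazur–Tate sigma function.
* `padicValNat_den_parallelogram` is the LOCAL statement at one prime `ℓ` for a `ℤ`-integral
  equation (ATAEC VI.4.1 needs only `ℓ`-integrality and `P, Q, P ± Q ∈ E₀(ℚ_ℓ)`); the global
  identity `den x(P+Q) · den x(P-Q) = den x(P)² den x(Q)² (x(P) - x(Q))²` used in MST §2.8 /
  SW §4.1 follows prime by prime.
* Sanity checks performed (exact arithmetic, outside Lean): the encodings `SatisfiesSigmaODE`,
  `IsFormallyOdd` of `PadicSigma.lean` hold for `σ_classical ∘ log_W` (`c = b₂/12`) on four test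
  curves; the point form of the theta relation holds with the chord-tangent law; the denominator
  law holds on several thousand (prime, pair) instances on `37a1`, `389a1`, `5077a1`, a non-minimal
  model and a curve with a node, exactly when the four points reduce non-singularly.
-/

noncomputable section

open scoped Classical

namespace Literature.NumberTheory.EllipticCurves

section Extension

variable {A : Type*} [AddCommGroup A] {L : Type*} [Field L] [CharZero L]

/-- Every additive map from a subgroup `H ≤ A` into a field of characteristic zero extends to
`A` (`L` is a `ℚ`-vector space, hence a divisible, hence injective, `ℤ`-module: Baer's criterion,
Mathlib `Module.Baer.of_divisible`). [folklore] -/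
theorem exists_addMonoidHom_comp_subtype_eq (H : AddSubgroup A) (g : H →+ L) :
    ∃ f : A →+ L, f.comp H.subtype = g :=
  (Module.Baer.of_divisible L).extension_property_addMonoidHom H.subtype H.subtype_injective g

/-- Restriction of `L`-valued additive maps to a subgroup, as an `L`-linear map. [folklore] -/
def restrictHomₗ (H : AddSubgroup A) (L : Type*) [Field L] :
    (A →+ L) →ₗ[L] (H →+ L) where
  toFun f := f.comp H.subtype
  map_add' f g := by ext; simp
  map_smul' c f := by ext; simp

omit [CharZero L] in
/-- Unfolding `restrictHomₗ`. [folklore] -/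
@[simp] theorem restrictHomₗ_apply (H : AddSubgroup A) (f : A →+ L) (h : H) :
    restrictHomₗ H L f h = f h := rfl

/-- **Extension of biadditive maps from a subgroup.** A biadditive map `H × H → L` into a field
of characteristic zero extends to a biadditive map `A × A → L`: extend in each variable through an
`L`-linear section of the (surjective) restriction map `(A →+ L) → (H →+ L)`. [folklore] -/
theorem exists_biadditive_extend (H : AddSubgroup A) (B : H →+ H →+ L) :
    ∃ B' : A →+ A →+ L, ∀ P Q : H, B' P Q = B P Q := by
  have hsurj : LinearMap.range (restrictHomₗ H L) = ⊤ := by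
    refine LinearMap.range_eq_top.mpr fun g => ?_
    obtain ⟨f, hf⟩ := exists_addMonoidHom_comp_subtype_eq H g
    exact ⟨f, hf⟩
  obtain ⟨s, hs⟩ := (restrictHomₗ H L).exists_rightInverse_of_surjective hsurj
  have hs' : ∀ (g : H →+ L) (h : H), s g (h : A) = g h := fun g h => by
    have := LinearMap.congr_fun hs g
    simp only [LinearMap.coe_comp, Function.comp_apply, LinearMap.id_coe, id_eq] at this
    simpa using DFunLike.congr_fun this h
  let B₁ : H →+ (A →+ L) := s.toAddMonoidHom.comp B
  let B₂ : A →+ (A →+ L) := s.toAddMonoidHom.comp B₁.flip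
  refine ⟨B₂.flip, fun P Q => ?_⟩
  simp only [B₂, B₁, AddMonoidHom.flip_apply, AddMonoidHom.coe_comp, Function.comp_apply,
    LinearMap.toAddMonoidHom_coe]
  rw [hs', AddMonoidHom.flip_apply, AddMonoidHom.comp_apply, LinearMap.toAddMonoidHom_coe, hs']

/-- A biadditive map into a field of characteristic zero kills torsion. [folklore] -/
theorem biadditive_map_of_isOfFinAddOrder (B : A →+ A →+ L) {P : A} (hP : IsOfFinAddOrder P)
    (Q : A) : B P Q = 0 := by
  obtain ⟨n, hn, hnP⟩ := hP.exists_nsmul_eq_zero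
  have : (n : L) * B P Q = 0 := by
    rw [← nsmul_eq_mul, ← AddMonoidHom.nsmul_apply, ← map_nsmul, hnP, map_zero,
      AddMonoidHom.zero_apply]
  exact (mul_eq_zero.mp this).resolve_left (by exact_mod_cast hn.ne')

end Extension

section Parallelogram

variable {A : Type*} [AddCommGroup A] {L : Type*} [Field L] [CharZero L]

/-- **Jordan–von Neumann on a subgroup, then extend.** If `q : A → L` (`L` a field of
characteristic zero) satisfies the parallelogram law `q(P+Q) + q(P-Q) = 2q(P) + 2q(Q)` for all
`P, Q` in a subgroup `H`, then there is a symmetric biadditive torsion-vanishing pairing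
`B : A →+ A →+ L` whose quadratic form restricts to `q` on `H`. (On `H`,
`D(a,b) = q(a+b) - q(a-b)` is biadditive and `D(a,a) = 4q(a)`; extend `D/4` by
`Literature.NumberTheory.EllipticCurves.exists_biadditive_extend` and symmetrise.) [folklore] -/
theorem exists_pairing_of_parallelogram (H : AddSubgroup A) (q : A → L)
    (hq : ∀ P ∈ H, ∀ Q ∈ H, q (P + Q) + q (P - Q) = 2 * q P + 2 * q Q) :
    ∃ B : A →+ A →+ L, (∀ P Q, B P Q = B Q P) ∧ (∀ P Q, IsOfFinAddOrder P → B P Q = 0) ∧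
      ∀ P ∈ H, B P P = q P := by
  -- `q 0 = 0` and `q` is even on `H`
  have h0 : q 0 = 0 := by
    have h := hq 0 H.zero_mem 0 H.zero_mem
    simp only [add_zero, sub_zero] at h
    have h2 : (2 : L) * q 0 = 0 := by linear_combination -h
    exact (mul_eq_zero.mp h2).resolve_left two_ne_zero
  have heven : ∀ P ∈ H, q (-P) = q P := fun P hP => by
    have h := hq 0 H.zero_mem P hP
    simp only [zero_add, zero_sub, h0, mul_zero] at h
    linear_combination h
  -- the biadditive map `D(a,b) = q(a+b) - q(a-b)` on `H`
  have hadd : ∀ x ∈ H, ∀ y ∈ H, ∀ z ∈ H,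
      q (x + y + z) - q (x + y - z) = (q (x + z) - q (x - z)) + (q (y + z) - q (y - z)) := by
    intro x hx y hy z hz
    have h1 := hq (x + z) (H.add_mem hx hz) y hy
    have h2 := hq (y + z) (H.add_mem hy hz) x hx
    have h3 := hq (x - z) (H.sub_mem hx hz) y hy
    have h4 := hq (y - z) (H.sub_mem hy hz) x hx
    have e1 : q (x + z - y) = q (y - z - x) := by
      rw [← heven _ (H.sub_mem (H.sub_mem hy hz) hx)]; congr 1; abel
    have e2 : q (y + z - x) = q (x - z - y) := by
      rw [← heven _ (H.sub_mem (H.sub_mem hx hz) hy)]; congr 1; abel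
    rw [show x + z + y = x + y + z by abel] at h1
    rw [show y + z + x = x + y + z by abel] at h2
    rw [show x - z + y = x + y - z by abel] at h3
    rw [show y - z + x = x + y - z by abel] at h4
    have key : (2 : L) * (q (x + y + z) - q (x + y - z)) =
        2 * ((q (x + z) - q (x - z)) + (q (y + z) - q (y - z))) := by
      linear_combination h1 + h2 - h3 - h4 - e1 - e2
    exact mul_left_cancel₀ two_ne_zero key
  have hsymm : ∀ x ∈ H, ∀ y ∈ H, q (x + y) - q (x - y) = q (y + x) - q (y - x) := by
    intro x hx y hy
    rw [add_comm y x, ← heven _ (H.sub_mem hx hy), neg_sub]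
  let D₀ : H → H →+ L := fun a =>
    { toFun := fun b => q ((a : A) + b) - q ((a : A) - b)
      map_zero' := by simp
      map_add' := fun b c => by
        simp only [AddSubgroup.coe_add]
        rw [hsymm _ a.2 _ (H.add_mem b.2 c.2), hadd _ b.2 _ c.2 _ a.2, hsymm _ b.2 _ a.2,
          hsymm _ c.2 _ a.2] }
  let D : H →+ H →+ L :=
    { toFun := D₀
      map_zero' := by
        ext b
        simp [D₀, heven _ b.2]
      map_add' := fun a c => by
        ext b
        simp only [D₀, AddSubgroup.coe_add, AddMonoidHom.coe_mk, ZeroHom.coe_mk,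
          AddMonoidHom.add_apply]
        exact hadd _ a.2 _ c.2 _ b.2 }
  obtain ⟨B', hB'⟩ := exists_biadditive_extend H D
  -- symmetrise and rescale: `B = (B' + B'ᵀ)/8`
  let B : A →+ A →+ L := (8 : L)⁻¹ • (B' + B'.flip)
  have hB : ∀ P Q, B P Q = (8 : L)⁻¹ * (B' P Q + B' Q P) := fun P Q => by
    simp only [B, AddMonoidHom.smul_apply, AddMonoidHom.add_apply, AddMonoidHom.flip_apply,
      smul_eq_mul]
  refine ⟨B, fun P Q => by rw [hB, hB, add_comm], fun P Q hP =>
    biadditive_map_of_isOfFinAddOrder B hP Q, fun P hP => ?_⟩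
  have hD : B' P P = 4 * q P := by
    have := hB' ⟨P, hP⟩ ⟨P, hP⟩
    simp only [D, D₀, AddMonoidHom.coe_mk, ZeroHom.coe_mk, sub_self, h0, sub_zero] at this
    rw [this]
    have h := hq P hP P hP
    rw [sub_self, h0, ← two_mul] at h
    linear_combination h
  rw [hB, hD]
  have : (8 : L) ≠ 0 := by norm_num
  field_simp
  ring

/-- In a subgroup `H` without torsion, `n • P ≠ 0` for `P ≠ 0`, `n ≠ 0`. [folklore] -/
theorem nsmul_ne_zero_of_torsionFree (H : AddSubgroup A)
    (hH : ∀ P ∈ H, IsOfFinAddOrder P → P = 0) {P : A} (hP : P ∈ H) (hP0 : P ≠ 0) {n : ℕ}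
    (hn : n ≠ 0) : n • P ≠ 0 := fun h =>
  hP0 (hH P hP (isOfFinAddOrder_iff_nsmul_eq_zero.mpr ⟨n, Nat.pos_of_ne_zero hn, h⟩))

/-- **From the generic parallelogram law to the full one.** On a torsion-free subgroup `H`, if
`q(0) = 0` and `q(P+Q) + q(P-Q) = 2q(P) + 2q(Q)` holds for all `P, Q ∈ H` with
`P, Q, P - Q, P + Q ≠ 0` (the "generic" pairs, for which the sigma-function and local-height
identities are stated in print), then it holds for all `P, Q ∈ H`: evenness of `q` follows from
the pairs `(2R, R)`, `(R, 2R)`, and `q(2P) = 4q(P)` from the pairs `(2P,P), (3P,P), (3P,2P),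
(4P,P)`. [folklore] -/
theorem parallelogram_of_generic (H : AddSubgroup A) (hH : ∀ P ∈ H, IsOfFinAddOrder P → P = 0)
    (q : A → L) (h0 : q 0 = 0)
    (hq : ∀ P ∈ H, ∀ Q ∈ H, P ≠ 0 → Q ≠ 0 → P - Q ≠ 0 → P + Q ≠ 0 →
      q (P + Q) + q (P - Q) = 2 * q P + 2 * q Q) :
    ∀ P ∈ H, ∀ Q ∈ H, q (P + Q) + q (P - Q) = 2 * q P + 2 * q Q := by
  have hns : ∀ P ∈ H, P ≠ 0 → ∀ {n : ℕ}, n ≠ 0 → n • P ≠ 0 := fun P hP hP0 n hn =>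
    nsmul_ne_zero_of_torsionFree H hH hP hP0 hn
  have hmem : ∀ P ∈ H, ∀ n : ℕ, n • P ∈ H := fun P hP n => H.nsmul_mem hP n
  -- evenness
  have heven : ∀ R ∈ H, q (-R) = q R := by
    intro R hR
    by_cases hR0 : R = 0
    · rw [hR0, neg_zero]
    have h3 : (3 : ℕ) • R ≠ 0 := hns R hR hR0 (by norm_num)
    have E1 := hq ((2 : ℕ) • R) (hmem R hR 2) R hR (hns R hR hR0 (by norm_num)) hR0
      (by rwa [show (2 : ℕ) • R - R = R by abel])
      (by rwa [show (2 : ℕ) • R + R = (3 : ℕ) • R by abel])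
    have E2 := hq R hR ((2 : ℕ) • R) (hmem R hR 2) hR0 (hns R hR hR0 (by norm_num))
      (by rw [show R - (2 : ℕ) • R = -R by abel]; exact neg_ne_zero.mpr hR0)
      (by rwa [show R + (2 : ℕ) • R = (3 : ℕ) • R by abel])
    rw [show (2 : ℕ) • R - R = R by abel, show (2 : ℕ) • R + R = (3 : ℕ) • R by abel] at E1
    rw [show R - (2 : ℕ) • R = -R by abel, show R + (2 : ℕ) • R = (3 : ℕ) • R by abel] at E2
    linear_combination E2 - E1
  -- duplication
  have hdouble : ∀ P ∈ H, q ((2 : ℕ) • P) = 4 * q P := by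
    intro P hP
    by_cases hP0 : P = 0
    · rw [hP0, smul_zero, h0, mul_zero]
    have hn : ∀ {n : ℕ}, n ≠ 0 → n • P ≠ 0 := fun hn => hns P hP hP0 hn
    have E1 := hq ((2 : ℕ) • P) (hmem P hP 2) P hP (hn (by norm_num)) hP0
      (by rw [show (2 : ℕ) • P - P = P by abel]; exact hP0)
      (by rw [show (2 : ℕ) • P + P = (3 : ℕ) • P by abel]; exact hn (by norm_num))
    have E2 := hq ((3 : ℕ) • P) (hmem P hP 3) P hP (hn (by norm_num)) hP0
      (by rw [show (3 : ℕ) • P - P = (2 : ℕ) • P by abel]; exact hn (by norm_num))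
      (by rw [show (3 : ℕ) • P + P = (4 : ℕ) • P by abel]; exact hn (by norm_num))
    have E3 := hq ((3 : ℕ) • P) (hmem P hP 3) ((2 : ℕ) • P) (hmem P hP 2) (hn (by norm_num))
      (hn (by norm_num)) (by rw [show (3 : ℕ) • P - (2 : ℕ) • P = P by abel]; exact hP0)
      (by rw [show (3 : ℕ) • P + (2 : ℕ) • P = (5 : ℕ) • P by abel]; exact hn (by norm_num))
    have E4 := hq ((4 : ℕ) • P) (hmem P hP 4) P hP (hn (by norm_num)) hP0
      (by rw [show (4 : ℕ) • P - P = (3 : ℕ) • P by abel]; exact hn (by norm_num))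
      (by rw [show (4 : ℕ) • P + P = (5 : ℕ) • P by abel]; exact hn (by norm_num))
    rw [show (2 : ℕ) • P - P = P by abel, show (2 : ℕ) • P + P = (3 : ℕ) • P by abel] at E1
    rw [show (3 : ℕ) • P - P = (2 : ℕ) • P by abel,
      show (3 : ℕ) • P + P = (4 : ℕ) • P by abel] at E2
    rw [show (3 : ℕ) • P - (2 : ℕ) • P = P by abel,
      show (3 : ℕ) • P + (2 : ℕ) • P = (5 : ℕ) • P by abel] at E3
    rw [show (4 : ℕ) • P - P = (3 : ℕ) • P by abel,
      show (4 : ℕ) • P + P = (5 : ℕ) • P by abel] at E4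
    have key : (2 : L) * q ((2 : ℕ) • P) = 2 * (4 * q P) := by
      linear_combination E1 + 2 * E2 - E3 + E4
    exact mul_left_cancel₀ two_ne_zero key
  -- all cases
  intro P hP Q hQ
  by_cases hP0 : P = 0
  · rw [hP0, zero_add, zero_sub, heven Q hQ, h0]; ring
  by_cases hQ0 : Q = 0
  · rw [hQ0, add_zero, sub_zero, h0]; ring
  by_cases hPQ : P - Q = 0
  · rw [sub_eq_zero] at hPQ
    rw [hPQ, sub_self, h0, ← two_nsmul, hdouble Q hQ]; ring
  by_cases hPQ' : P + Q = 0
  · have hQ' : Q = -P := by rwa [add_eq_zero_iff_eq_neg'] at hPQ'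
    rw [hPQ', h0, hQ', sub_neg_eq_add, ← two_nsmul, hdouble P hP, heven P hP]; ring
  exact hq P hP Q hQ hP0 hQ0 hPQ hPQ'

end Parallelogram

end Literature.NumberTheory.EllipticCurves

namespace WeierstrassCurve

variable (W : WeierstrassCurve ℚ) (p : ℕ) [Fact p.Prime]

/-! ### Coordinates, the parameter `z(P)` and `σ_p(z(P))` for points of `E(ℚ)` -/

/-- The `x`-coordinate of an affine point of `E(ℚ)` (junk `0` at `O`). [folklore] -/
def xCoord : W.toAffine.Point → ℚ
  | .zero => 0
  | .some x _ _ => x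

/-- The parameter `z(P) = -x(P)/y(P) ∈ ℚ_p` of a point of `E(ℚ)` (`z(O) = 0`; junk `0` if
`y(P) = 0`), as used in `canonicalPAdicHeight`. [Silverman AEC IV.1, VII.2.2; Mazur–Stein–Tate
2006, Thm. 1.3 ("by `σ(P)` we mean `σ(-x/y)`")] [cite: MazurSteinTate2006, Thm. 1.3] -/
def padicParam : W.toAffine.Point → ℚ_[p]
  | .zero => 0
  | .some x y _ => -(x : ℚ_[p]) / y

/-- `σ_p(P) := σ_p(z(P))`, the canonical `p`-adic sigma function evaluated at the parameter of
`P` (`padicSigmaEval ∘ padicParam`).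
[Mazur–Stein–Tate 2006, §1 eq. (1.1) and Thm. 1.3] [cite: MazurSteinTate2006, Thm. 1.3] -/
def padicSigmaAt (P : W.toAffine.Point) : ℚ_[p] :=
  W.padicSigmaEval p (W.padicParam p P)

/-- **Non-singular reduction of a point of `E(ℚ)` modulo `ℓ`** (point-level wrapper of
`HasNonsingularReductionAt`; `O` reduces to the non-singular point `Õ`).
[Silverman AEC VII.2 (`E₀`)] [folklore] -/
def ReducesNonsingularlyAt (ℓ : ℕ) : W.toAffine.Point → Prop
  | .zero => True
  | .some x y _ => W.HasNonsingularReductionAt ℓ x y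

/-- **The admissible locus with `O` adjoined**: `{O} ∪ {P | SatisfiesLocalConditions p P}`, i.e.
(for `W` globally minimal, `p` odd) `E(ℚ) ∩ E₁(ℚ_p) ∩ ⋂_ℓ E⁰(ℚ_ℓ)`, the finite-index subgroup on
which the sigma formula computes the height. [Mazur–Stein–Tate 2006, §1, §2.7; Stein–Wuthrich
2013, §4.1] [cite: MazurSteinTate2006, §2.7] -/
def localConditionsLocus : Set W.toAffine.Point :=
  {P | P = 0 ∨ W.SatisfiesLocalConditions p P}

/-! ### API -/

/-- `x(O) = 0` (junk). [folklore] -/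
@[simp] theorem xCoord_zero : W.xCoord 0 = 0 := rfl

/-- `x((x, y)) = x`. [folklore] -/
theorem xCoord_some {x y : ℚ} (h : W.toAffine.Nonsingular x y) : W.xCoord (.some x y h) = x :=
  rfl

/-- `z(O) = 0`. [folklore] -/
@[simp] theorem padicParam_zero : W.padicParam p 0 = 0 := rfl

/-- `z((x, y)) = -x/y`. [Silverman AEC IV.1] [folklore] -/
theorem padicParam_some {x y : ℚ} (h : W.toAffine.Nonsingular x y) :
    W.padicParam p (.some x y h) = -(x : ℚ_[p]) / y := rfl

/-- `σ_p(O) = σ_p(0) = 0`. [folklore] -/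
@[simp] theorem padicSigmaAt_zero : W.padicSigmaAt p 0 = 0 := by
  simp [padicSigmaAt]

/-- `ĥ_p(O) = 0` (by definition). [folklore] -/
@[simp] theorem canonicalPAdicHeight_zero : W.canonicalPAdicHeight p 0 = 0 := rfl

/-- The sigma formula, unfolded: `ĥ_p(P) = log_p(den x(P)) - 2 log_p σ_p(z(P))` for `P ≠ O`.
[Stein–Wuthrich 2013, §4.1 eq. (4.1)] [folklore] -/
theorem canonicalPAdicHeight_some {x y : ℚ} (h : W.toAffine.Nonsingular x y) :
    W.canonicalPAdicHeight p (.some x y h) =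
      Literature.NumberTheory.EllipticCurves.padicLog p ((x.den : ℚ) : ℚ_[p]) - 2 * Literature.NumberTheory.EllipticCurves.padicLog p (W.padicSigmaAt p (.some x y h)) :=
  rfl

/-- `O` reduces to the non-singular point `Õ`. [folklore] -/
@[simp] theorem reducesNonsingularlyAt_zero (ℓ : ℕ) : W.ReducesNonsingularlyAt ℓ 0 := trivial

/-- Unfolding `ReducesNonsingularlyAt` on an affine point. [folklore] -/
theorem reducesNonsingularlyAt_some (ℓ : ℕ) {x y : ℚ} (h : W.toAffine.Nonsingular x y) :
    W.ReducesNonsingularlyAt ℓ (.some x y h) ↔ W.HasNonsingularReductionAt ℓ x y := Iff.rfl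

/-- `O` lies in the locus. [folklore] -/
@[simp] theorem zero_mem_localConditionsLocus : (0 : W.toAffine.Point) ∈ W.localConditionsLocus p :=
  Or.inl rfl

/-- Membership in the locus, unfolded. [folklore] -/
theorem mem_localConditionsLocus_iff (P : W.toAffine.Point) :
    P ∈ W.localConditionsLocus p ↔ P = 0 ∨ W.SatisfiesLocalConditions p P := Iff.rfl

/-- `O` does not satisfy the local conditions (they are stated for affine points). [folklore] -/
theorem not_satisfiesLocalConditions_zero : ¬ W.SatisfiesLocalConditions p 0 := fun h => h

variable {W p} in
/-- A point satisfying the local conditions is not `O`. [folklore] -/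
theorem ne_zero_of_satisfiesLocalConditions {P : W.toAffine.Point}
    (h : W.SatisfiesLocalConditions p P) : P ≠ 0 := by
  rintro rfl; exact h

variable {W p} in
/-- A non-zero point of the locus satisfies the local conditions. [folklore] -/
theorem mem_localConditionsLocus_of_ne_zero {P : W.toAffine.Point}
    (hP : P ∈ W.localConditionsLocus p) (h0 : P ≠ 0) : W.SatisfiesLocalConditions p P :=
  hP.resolve_left h0

variable {W p} in
/-- Admissible points lie in the locus. [folklore] -/
theorem IsAdmissible.mem_localConditionsLocus {P : W.toAffine.Point} (h : W.IsAdmissible p P) :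
    P ∈ W.localConditionsLocus p :=
  Or.inr h.2

/-! ### Named facts: the three inputs of the assembly (nothing asserted) -/

/-- **`{O} ∪ {admissible locus}` is a subgroup of `E(ℚ)`.** For `W/ℚ` globally minimal and a
prime `p`, the set `{O} ∪ {P | SatisfiesLocalConditions p P}` is (the underlying set of) a
subgroup: the points with non-singular reduction modulo `ℓ` form the subgroup `E₀(ℚ_ℓ)`
(AEC VII.2.1, for a minimal — indeed any `ℓ`-integral — equation); the points with
`‖x‖_p > 1` together with `O` form the subgroup `E₁(ℚ_p) ≅ Ê(pℤ_p)`, `P ↦ z(P) = -x/y`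
(AEC VII.2.2), on which `z(P + Q) = F(z(P), z(Q))` with `F ∈ ℤ_p⟦z₁, z₂⟧`, so that the sigma disc
`‖z‖ < p^{-1/(p-1)}` (an ideal of `ℤ_p`) is preserved as well (AEC IV.3.2(a): `Ê(𝓜ⁿ)` is a
subgroup), and `z(-P) = i(z(P))` has the same norm. [Silverman AEC VII.2.1, VII.2.2, IV.3.2(a);
Mazur–Stein–Tate 2006, §2.6 ("sufficiently small (finite index) subgroup")]
[cite: SilvermanAEC2009, VII.2.1] -/
def localConditionsLocus_isAddSubgroup : Prop :=
  ∀ (W : WeierstrassCurve ℚ) [W.IsElliptic] [W.IsGloballyMinimal] (p : ℕ) [Fact p.Prime],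
    ∃ H : AddSubgroup W.toAffine.Point, (H : Set W.toAffine.Point) = W.localConditionsLocus p

/-- **`E₁(ℚ_p)` has no torsion for `p` odd.** For `W/ℚ` globally minimal (so `p`-integral) and
a prime `p ≥ 3`, a point `P = (x, y) ∈ E(ℚ)` with `‖x‖_p > 1`, i.e. reducing to `Õ` modulo `p`,
has infinite order: `E₁(ℚ_p) ≅ Ê(pℤ_p)` (AEC VII.2.2) has no prime-to-`p` torsion
(AEC IV.3.2(b)) and, since `v(p) = 1 < p - 1`, no `p`-power torsion (AEC IV.6.1: an element of
exact order `pⁿ` has `v(z) ≤ v(p)/(pⁿ - pⁿ⁻¹)`). [Silverman AEC IV.6.1, IV.3.2(b), VII.2.2,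
VII.3.1] [cite: SilvermanAEC2009, IV.6.1] -/
def not_isOfFinAddOrder_of_one_lt_padicNorm : Prop :=
  ∀ (W : WeierstrassCurve ℚ) [W.IsElliptic] [W.IsGloballyMinimal] (p : ℕ) [Fact p.Prime],
    3 ≤ p → ∀ {x y : ℚ} (h : W.toAffine.Nonsingular x y), 1 < ‖(x : ℚ_[p])‖ →
      ¬ IsOfFinAddOrder (.some x y h : W.toAffine.Point)

/-- **The sigma formula is a quadratic function: parallelogram law on generic admissible pairs.**
For `W/ℚ` globally minimal and a prime `p ≥ 5` of good ordinary reduction, and `P, Q ∈ E(ℚ)`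
both satisfying the local conditions (in `E₁(ℚ_p)`, in the sigma disc, non-singular reduction
everywhere) with `P ≠ ±Q`,
`ĥ_p(P + Q) + ĥ_p(P - Q) = 2 ĥ_p(P) + 2 ĥ_p(Q)`, `ĥ_p = canonicalPAdicHeight` (`= -2p ·` MST's
`h_p`). Printed proof: `h_p(P) = p⁻¹ log_p(σ(P)/d(P))` and "`h_ρ` is quadratic because of
property IV of `σ` in [MT91] … see also property III" (MST 2006, §2.7), i.e. the theta relation
`σ(u+v)σ(u-v)/(σ(u)²σ(v)²) = x(v) - x(u)` on the kernel of reduction (`padicSigma_theta` below)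
together with Néron's quasi-parallelogram law for the denominators at every `ℓ`
(`padicValNat_den_parallelogram` below) and `log_p(ab) = log_p a + log_p b`, `log_p(-1) = 0`
(`Literature.NumberTheory.EllipticCurves.padicLog_mul`). [Mazur–Stein–Tate 2006, §1 ("extends uniquely … `h_p(nQ) = n² h_p(Q)`"),
§2.6–2.7; Stein–Wuthrich 2013, §4.1 eq. (4.1); Mazur–Tate 1991 (properties III–IV of `σ`, as cited
in MST 2006 §2.7)]
[cite: MazurSteinTate2006, §2.7] -/
def canonicalPAdicHeight_parallelogram : Prop :=
  ∀ (W : WeierstrassCurve ℚ) [W.IsElliptic] [W.IsGloballyMinimal] (p : ℕ) [Fact p.Prime],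
    5 ≤ p → W.HasGoodReductionAtPrime p → ¬ (p : ℤ) ∣ W.frobeniusTrace p →
      ∀ P Q : W.toAffine.Point, W.SatisfiesLocalConditions p P → W.SatisfiesLocalConditions p Q →
        P - Q ≠ 0 → P + Q ≠ 0 →
          W.canonicalPAdicHeight p (P + Q) + W.canonicalPAdicHeight p (P - Q) =
            2 * W.canonicalPAdicHeight p P + 2 * W.canonicalPAdicHeight p Q

/-! ### Named facts: the next layer, behind `canonicalPAdicHeight_parallelogram`
(nothing asserted) -/

/-- **The Mazur–Tate theta relation of `σ_p`, on points of `E(ℚ)` in the kernel of reduction.**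
For `W/ℚ` globally minimal and a prime `p ≥ 5` of good ordinary reduction (so that `padicSigma`
of `W ⊗ ℚ_p` is the Mazur–Tate sigma function, `mazur_tate_sigma_existsUnique`), and
`P = (x₁, y₁)`, `Q = (x₂, y₂) ∈ E(ℚ)` with `‖x₁‖_p, ‖x₂‖_p > 1` and `x₁ ≠ x₂` (`Q ≠ ±P`):
`σ_p(z(P+Q)) · σ_p(z(P-Q)) = (x₂ - x₁) · σ_p(z(P))² · σ_p(z(Q))²`,
`z(R) = -x(R)/y(R)` (here `P ± Q ∈ E₁(ℚ_p)` again, AEC VII.2.2). This is Mazur–Tate's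
characterising property "for all `u, v` in the kernel of reduction,
`σ(u +_E v) σ(u -_E v)/(σ(u)² σ(v)²) = x(v) - x(u)`" (as quoted in Blakestad–Grant 2023, §3),
proved universally from the sigma differential equation and oddness in Blakestad–Grant 2023,
Prop. 14; it is "property IV of `σ`" invoked by Mazur–Stein–Tate 2006, §2.7.
[Blakestad–Grant 2023, §3 and Prop. 14; Mazur–Tate 1991 (as cited there and in MST 2006 §2.7);
Mazur–Stein–Tate 2006, §2.3, §2.7] [cite: BlakestadGrant2023, Prop. 14] -/
def padicSigma_theta : Prop :=
  ∀ (W : WeierstrassCurve ℚ) [W.IsElliptic] [W.IsGloballyMinimal] (p : ℕ) [Fact p.Prime],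
    5 ≤ p → W.HasGoodReductionAtPrime p → ¬ (p : ℤ) ∣ W.frobeniusTrace p →
      ∀ {x₁ y₁ x₂ y₂ : ℚ} (h₁ : W.toAffine.Nonsingular x₁ y₁) (h₂ : W.toAffine.Nonsingular x₂ y₂),
        1 < ‖(x₁ : ℚ_[p])‖ → 1 < ‖(x₂ : ℚ_[p])‖ → x₁ ≠ x₂ →
          W.padicSigmaAt p (.some x₁ y₁ h₁ + .some x₂ y₂ h₂) *
              W.padicSigmaAt p (.some x₁ y₁ h₁ - .some x₂ y₂ h₂) =
            ((x₂ : ℚ_[p]) - x₁) * W.padicSigmaAt p (.some x₁ y₁ h₁) ^ 2 *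
              W.padicSigmaAt p (.some x₂ y₂ h₂) ^ 2

/-- **Néron's quasi-parallelogram law at a prime of non-singular reduction, denominator form.**
For `W/ℚ` an elliptic curve with integer coefficients, a prime `ℓ`, and `P = (x₁, y₁)`,
`Q = (x₂, y₂) ∈ E(ℚ)` with `x₁ ≠ x₂` (so `P ± Q ≠ O`) such that `P`, `Q`, `P + Q`, `P - Q` all
reduce to non-singular points modulo `ℓ`:
`m(P+Q) + m(P-Q) = 2 m(P) + 2 m(Q) + 2 ord_ℓ(x₁ - x₂)`, where
`m(R) = ord_ℓ(den x(R)) = max{0, -ord_ℓ x(R)}`. This is ATAEC Thm. VI.4.1 — for an `ℓ`-integral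
equation over the complete field `ℚ_ℓ` the Néron local height is
`λ(R) = ½ max{v(x(R)⁻¹), 0} + v(Δ)/12` for all `R ∈ E₀(ℚ_ℓ)` — inserted into the
quasi-parallelogram law `λ(P+Q) + λ(P-Q) = 2λ(P) + 2λ(Q) + v(x(P) - x(Q)) - v(Δ)/6`
(`P, Q, P ± Q ≠ O`; ATAEC Ex. 6.3, archimedean case Cor. VI.3.3), times `2`.
[Silverman ATAEC VI.4.1, Ex. 6.3, Thm. VI.1.1; Mazur–Stein–Tate 2006, §2.4 (`σ̃_v`, `λ_v`)]
[cite: SilvermanATAEC1994, VI.4.1 and Ex. 6.3] -/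
def padicValNat_den_parallelogram : Prop :=
  ∀ (W : WeierstrassCurve ℚ) [W.IsElliptic] [W.IsIntegral ℤ] (ℓ : ℕ) [Fact ℓ.Prime]
    {x₁ y₁ x₂ y₂ : ℚ} (h₁ : W.toAffine.Nonsingular x₁ y₁) (h₂ : W.toAffine.Nonsingular x₂ y₂),
    x₁ ≠ x₂ → W.HasNonsingularReductionAt ℓ x₁ y₁ → W.HasNonsingularReductionAt ℓ x₂ y₂ →
      W.ReducesNonsingularlyAt ℓ (.some x₁ y₁ h₁ + .some x₂ y₂ h₂) →
        W.ReducesNonsingularlyAt ℓ (.some x₁ y₁ h₁ - .some x₂ y₂ h₂) →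
          (padicValNat ℓ (W.xCoord (.some x₁ y₁ h₁ + .some x₂ y₂ h₂)).den : ℤ) +
              padicValNat ℓ (W.xCoord (.some x₁ y₁ h₁ - .some x₂ y₂ h₂)).den =
            2 * padicValNat ℓ x₁.den + 2 * padicValNat ℓ x₂.den + 2 * padicValRat ℓ (x₁ - x₂)

/-! ### The assembly: existence of the canonical datum from the three inputs -/

/-- **Existence of the canonical `p`-adic height datum**, from: the admissible locus (with `O`)
is a subgroup (`localConditionsLocus_isAddSubgroup`, AEC VII.2.1–2.2), `E₁(ℚ_p)` is
torsion-free for `p` odd (`not_isOfFinAddOrder_of_one_lt_padicNorm`, AEC IV.6.1), and the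
parallelogram law of the sigma formula on generic admissible pairs
(`canonicalPAdicHeight_parallelogram`, MST 2006 §2.7 / MT 1991). Proof: the generic law
upgrades to the full parallelogram law on the subgroup (`Literature.NumberTheory.EllipticCurves.parallelogram_of_generic`), which by
Jordan–von Neumann gives a symmetric biadditive form on the subgroup, extended to `E(ℚ)` because
`ℚ_p` is an injective `ℤ`-module (`Literature.NumberTheory.EllipticCurves.exists_pairing_of_parallelogram`); it kills torsion since
`ℚ_p` is torsion-free. [Mazur–Stein–Tate 2006, §1 ("extends uniquely"), §2.6–2.7]
[cite: MazurSteinTate2006, §2.7] -/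
theorem exists_isCanonical_of_parallelogram (hH : localConditionsLocus_isAddSubgroup)
    (htf : not_isOfFinAddOrder_of_one_lt_padicNorm) (hpar : canonicalPAdicHeight_parallelogram) :
    exists_isCanonical := by
  intro W _ _ p _ hp hgood hord
  obtain ⟨H, hH⟩ := hH W p
  have hmem : ∀ P, P ∈ H ↔ P = 0 ∨ W.SatisfiesLocalConditions p P := fun P => by
    rw [← SetLike.mem_coe, hH]; rfl
  have hslc : ∀ P ∈ H, P ≠ 0 → W.SatisfiesLocalConditions p P := fun P hP h0 =>
    ((hmem P).mp hP).resolve_left h0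
  -- `H` is torsion-free
  have htf' : ∀ P ∈ H, IsOfFinAddOrder P → P = 0 := by
    intro P hP hfin
    by_contra h0
    have hP' := hslc P hP h0
    cases P with
    | zero => exact h0 rfl
    | some x y h => exact htf W p (by omega) h hP'.1 hfin
  -- the full parallelogram law on `H`
  have hfull := Literature.NumberTheory.EllipticCurves.parallelogram_of_generic H htf' (W.canonicalPAdicHeight p) rfl
    fun P hP Q hQ hP0 hQ0 hPQ hPQ' =>
      hpar W p hp hgood hord P Q (hslc P hP hP0) (hslc Q hQ hQ0) hPQ hPQ'
  obtain ⟨B, hsymm, htors, hdiag⟩ := Literature.NumberTheory.EllipticCurves.exists_pairing_of_parallelogram H _ hfull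
  exact ⟨⟨B, hsymm, fun P Q hP => htors P Q hP⟩,
    fun P hP => hdiag P ((hmem P).mpr (Or.inr hP.2))⟩

/-- The same, with uniqueness (`PAdicHeightData.isCanonical_unique`): given moreover admissible
multiples (`exists_admissible_nsmul`), there is EXACTLY ONE canonical datum.
[Mazur–Stein–Tate 2006, §1 ("extends uniquely")] [folklore] -/
theorem existsUnique_isCanonical_of_parallelogram (hH : localConditionsLocus_isAddSubgroup)
    (htf : not_isOfFinAddOrder_of_one_lt_padicNorm) (hpar : canonicalPAdicHeight_parallelogram)
    (hS : exists_admissible_nsmul) (W : WeierstrassCurve ℚ) [W.IsElliptic] [W.IsGloballyMinimal]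
    (p : ℕ) [Fact p.Prime] (hp : 5 ≤ p) (hgood : W.HasGoodReductionAtPrime p)
    (hord : ¬ (p : ℤ) ∣ W.frobeniusTrace p) : ∃! D : PAdicHeightData W p, D.IsCanonical := by
  obtain ⟨D, hD⟩ := exists_isCanonical_of_parallelogram hH htf hpar W p hp hgood hord
  exact ⟨D, hD, fun D' hD' => PAdicHeightData.isCanonical_unique (hS W p) hD' hD⟩

end WeierstrassCurve
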